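import Summits.FinalStateConjecture.FinalStateConjecture.Theorems.BartnikGapSettlingBondiBartnikRigiditySlabCauchyRigidityLensConnected
import HarnessLib

/-!
# The corrected inner diamond `Δ'` of a collar background is open and connected, and the exact
# diamond image accumulates at a slab point — bricks for the Killing PROPAGATION step β'
# (`stub_killingPropagation'`, K1a) of the line `direct-method-on-the-cone`, crux
# `BondiBartnikRigidity` (stmt-FinalStateConjecture-10807); worker betaA of lead c3

Elementary facts about the corrected future inner diamond
`Δ' = F1Route.slabDiamond' B M = {0 < t*, 3t* + 2r < 6M}` of the boosted Kerr star background
`B = starBackground Λ c M a (r_a ∘ (Λ, c)⁻¹)` of a collar chart (`…SlabCauchyRigidityDefs.lean`),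
used by the conditional closer `…KillingPropagationOfFacts.lean` in its attachment step (G5):

* `isOpen_slabDiamond'` — `Δ'` is open (continuity of the rest-frame time and Kerr–Schild radius);
* `isPreconnected_slabDiamond'` — `Δ'` is connected for `0 < M`: in the rest frame it is the
  region under the graph of `y ↦ (6M − 2r(y))/3` over the connected open shell `{M < r < 3M}` of
  `E3` (`F1Route.isConnected_shell`), the image of `(0, 1) × shell`;
* `exists_slab_point_clusters` — a map `Ψ` continuous on `Δ' ∪ slab° = {0 ≤ t*, 3t* + 2r < 6M}`
  and equal to `Φ₀` on the thick slab takes, on `Δ'`, values in every neighbourhood of `Φ₀ x₀`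
  for a slab point `x₀` (approach `x₀ = Λ(0, y) + c` along the rest-frame time axis
  `ε ↦ x₀ + ε Λe₀`).

The registered brick `stub_killingPropagation_slabDiamondPreconnected` packages the first two.
Everything is proved; no definitions, no named facts.  References: O'Neill 1995, Ch. 2 §2.1
[ONeill1995]; Dafermos–Rodnianski arXiv:0811.0354, §5.1 (Kerr-star slabs) [DafermosRodnianski2008].
-/

noncomputable section

-- D-0017: single-problem summit, `Summit.<S>.<S>.…` by design (cf. lakefile `weak.linter.dupNamespace`).
set_option linter.dupNamespace false
set_option maxSynthPendingDepth 3

open Set Filter Function Topology TopologicalSpace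
open Literature.Geometry.Lorentzian
open scoped Manifold ContDiff Topology ENNReal

namespace Summit.FinalStateConjecture.FinalStateConjecture.Theorems.BondiBartnikRigidity.DirectMethod

namespace KillingPropagation


/-- The corrected inner diamond `Δ' = {0 < t*, 3t* + 2r < 6M}` of a background with continuous time
and radius functions is open. [folklore] -/
theorem isOpen_slabDiamond'_of_continuous {B : ModelBackground} (ht : Continuous B.time)
    (hr : Continuous B.radius) (M : ℝ) : IsOpen (F1Route.slabDiamond' B M) := by
  have h1 : Continuous fun x : B.domain ↦ B.time x.1 := ht.comp continuous_subtype_val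
  have h2 : Continuous fun x : B.domain ↦ B.radius x.1 := hr.comp continuous_subtype_val
  simp only [F1Route.slabDiamond', Set.setOf_and]
  exact (isOpen_lt continuous_const h1).inter (isOpen_lt (by fun_prop) continuous_const)

/-- The corrected inner diamond of the boosted Kerr star background of a collar chart is open.
[folklore] -/
theorem isOpen_slabDiamond' {mo : lorentzGroup × E4} {M a : ℝ} {B : ModelBackground}
    (hB : B = starBackground mo.1 mo.2 M a (fun x => Kerr.radius a (poincareInv mo.1 mo.2 x))) :
    IsOpen (F1Route.slabDiamond' B M) := by
  subst hB
  exact isOpen_slabDiamond'_of_continuous (continuous_time_starBackground mo.1 mo.2 M a _)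
    (continuous_radius_starBackground mo.1 mo.2 M a) M

/-- **The corrected inner diamond is connected** (`0 < M`): in the rest frame it is the region
`{(t*, y) : M < r(y) < 3M, 0 < t* < (6M − 2r(y))/3}` under the graph of a continuous function over
the connected open shell `{M < r < 3M}` of `E3`, the image of `(0, 1) × shell` under
`(s, y) ↦ Λ (s (6M − 2 r(y))/3, y) + c`. [folklore] -/
theorem isPreconnected_slabDiamond' {mo : lorentzGroup × E4} {M a : ℝ} {B : ModelBackground}
    (hM : 0 < M)
    (hB : B = starBackground mo.1 mo.2 M a (fun x => Kerr.radius a (poincareInv mo.1 mo.2 x))) :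
    IsPreconnected (F1Route.slabDiamond' B M) := by
  subst hB
  set Λ := mo.1 with hΛ
  set c := mo.2 with hc
  have hpia : ∀ w : E4, poincareInv Λ c ((Λ : E4 ≃L[ℝ] E4) w + c) = w := fun w ↦ by
    simp only [poincareInv, add_sub_cancel_right, ContinuousLinearEquiv.symm_apply_apply]
  have hapi : ∀ x : E4, (Λ : E4 ≃L[ℝ] E4) (poincareInv Λ c x) + c = x := fun x ↦ by
    simp only [poincareInv, ContinuousLinearEquiv.apply_symm_apply, sub_add_cancel]
  have hjoint : ∀ {f : ℝ × E3 → ℝ} {g : ℝ × E3 → E3}, Continuous f → Continuous g →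
      Continuous fun q ↦ E4.ofTimeSpace (f q) (g q) := fun {f g} hf hg ↦ by
    have h : (fun q ↦ E4.ofTimeSpace (f q) (g q)) =
        fun q ↦ E4.ofTimeSpace 0 (g q) + f q • E4.basisVector 0 := by
      funext q
      ext μ
      refine Fin.cases ?_ (fun j ↦ ?_) μ
      · simp
      · simp [Fin.succ_ne_zero]
    rw [h]
    exact ((E4.continuous_ofTimeSpace 0).comp hg).add (hf.smul continuous_const)
  set r : E3 → ℝ := fun y ↦ Kerr.radius a (E4.ofTimeSpace 0 y) with hr_def
  have hrc : Continuous r := (Kerr.continuous_radius a).comp (E4.continuous_ofTimeSpace 0)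
  set shell : Set E3 := {y : E3 | M < r y ∧ r y < 3 * M} with hshell
  have hshellc : IsConnected shell := F1Route.isConnected_shell a hM
  set f : ℝ × E3 → E4 := fun q ↦
    (Λ : E4 ≃L[ℝ] E4) (E4.ofTimeSpace (q.1 * (6 * M - 2 * r q.2) / 3) q.2) + c with hf_def
  have hfc : Continuous f := by
    refine (((Λ : E4 ≃L[ℝ] E4).continuous).comp (hjoint ?_ continuous_snd)).add
      continuous_const
    fun_prop
  have himg : Subtype.val '' F1Route.slabDiamond' (starBackground mo.1 mo.2 M a
      (fun x => Kerr.radius a (poincareInv mo.1 mo.2 x))) M = f '' (Ioo (0 : ℝ) 1 ×ˢ shell) := by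
    ext x
    constructor
    · rintro ⟨z, ⟨h0, h1⟩, rfl⟩
      -- rest-frame coordinates of `z`
      have h0' : 0 < poincareInv Λ c z.1 0 := h0
      have h1' : 3 * (poincareInv Λ c z.1 0) + 2 * Kerr.radius a (poincareInv Λ c z.1) < 6 * M := h1
      have hreg : max M 0 < Kerr.radius a (poincareInv Λ c z.1) := z.2
      set w : E4 := poincareInv Λ c z.1 with hw
      set y : E3 := E4.spatial w with hy
      set t : ℝ := E4.time w with ht
      have hwy : w = E4.ofTimeSpace t y := (E4.ofTimeSpace_time_spatial w).symm
      have hry : r y = Kerr.radius a w := by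
        show Kerr.radius a (E4.ofTimeSpace 0 (E4.spatial w)) = Kerr.radius a w
        exact Kerr.radius_ofTimeSpace_spatial a w
      have ht0 : t = w 0 := rfl
      rw [← ht0] at h0' h1'
      rw [← hry] at h1' hreg
      rw [max_eq_left hM.le] at hreg
      have hden : 0 < 6 * M - 2 * r y := by linarith
      set s : ℝ := 3 * t / (6 * M - 2 * r y) with hs
      refine ⟨(s, y), ⟨⟨div_pos (by linarith) hden, (div_lt_one hden).2 (by linarith)⟩, hreg, by linarith⟩, ?_⟩
      show (Λ : E4 ≃L[ℝ] E4) (E4.ofTimeSpace (s * (6 * M - 2 * r y) / 3) y) + c = z.1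
      have hst : s * (6 * M - 2 * r y) / 3 = t := by
        rw [hs]; field_simp
      rw [hst, ← hwy, hw, hapi]
    · rintro ⟨⟨s, y⟩, ⟨⟨hs0, hs1⟩, hy1, hy2⟩, rfl⟩
      have hden : 0 < 6 * M - 2 * r y := by linarith
      set t : ℝ := s * (6 * M - 2 * r y) / 3 with ht
      have ht0 : 0 < t := by rw [ht]; positivity
      have ht1 : 3 * t + 2 * r y < 6 * M := by
        rw [ht]
        nlinarith [mul_lt_mul_of_pos_right hs1 hden]
      have hpi : poincareInv Λ c (f (s, y)) = E4.ofTimeSpace t y := by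
        show poincareInv Λ c ((Λ : E4 ≃L[ℝ] E4) (E4.ofTimeSpace (s * (6 * M - 2 * r y) / 3) y) + c) = _
        rw [hpia]
      have hrad : Kerr.radius a (E4.ofTimeSpace t y) = r y := Kerr.radius_ofTimeSpace a t y
      have hmem : f (s, y) ∈ (starBackground mo.1 mo.2 M a
          (fun x => Kerr.radius a (poincareInv mo.1 mo.2 x))).domain := by
        show poincareInv Λ c (f (s, y)) ∈ Kerr.region a M
        rw [hpi, Kerr.mem_region, hrad, max_eq_left hM.le]
        exact hy1
      refine ⟨⟨f (s, y), hmem⟩, ⟨?_, ?_⟩, rfl⟩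
      · show 0 < poincareInv Λ c (f (s, y)) 0
        rw [hpi, E4.ofTimeSpace_apply_zero]; exact ht0
      · show 3 * (poincareInv Λ c (f (s, y)) 0) + 2 * Kerr.radius a (poincareInv Λ c (f (s, y))) < 6 * M
        rw [hpi, E4.ofTimeSpace_apply_zero, hrad]; exact ht1
  have hpre : IsPreconnected (f '' (Ioo (0 : ℝ) 1 ×ˢ shell)) :=
    ((isPreconnected_Ioo).prod hshellc.isPreconnected).image f hfc.continuousOn
  rw [← himg] at hpre
  exact IsInducing.subtypeVal.isPreconnected_image.mp hpre

/-- `(0, y) + ε ∂₀ = (ε, y)`. [folklore] -/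
theorem ofTimeSpace_zero_add_smul (ε : ℝ) (y : E3) :
    E4.ofTimeSpace 0 y + ε • E4.basisVector 0 = E4.ofTimeSpace ε y := by
  ext μ
  refine Fin.cases ?_ (fun j ↦ ?_) μ
  · simp
  · simp [Fin.succ_ne_zero]

/-- **The exact diamond image accumulates at a point of the thick slab.** For the star background
`B` of a collar chart (`0 < M`), a map `Ψ` continuous on `Δ' ∪ slab° = {0 ≤ t*, 3t* + 2r < 6M}`
which agrees with `Φ₀` on the thick slab `{t* = 0, r ≤ 3M}` takes, on the open diamond
`Δ' = {0 < t*, 3t* + 2r < 6M}`, values in every neighbourhood of `Φ₀ x₀` for a suitable slab point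
`x₀` (any point `(0, y)`, `M < r(y) < 3M`, approached along the rest-frame time axis
`ε ↦ x₀ + ε Λe₀`). [folklore] -/
theorem exists_slab_point_clusters {Y : Type*} [TopologicalSpace Y] {mo : lorentzGroup × E4}
    {M a : ℝ} {B : ModelBackground} {Φ₀ Ψ : B.domain → Y} (hM : 0 < M)
    (hB : B = starBackground mo.1 mo.2 M a (fun x => Kerr.radius a (poincareInv mo.1 mo.2 x)))
    (hΨΦ : ∀ x ∈ B.truncTimeSlab (3 * M) 0, Ψ x = Φ₀ x)
    (hc : ContinuousOn Ψ (F1Route.slabDiamondWithSlab' B M)) :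
    ∃ x₀ ∈ B.truncTimeSlab (3 * M) 0, ∀ W ∈ 𝓝 (Φ₀ x₀),
      ∃ x ∈ F1Route.slabDiamond' B M, Ψ x ∈ W := by
  subst hB
  have hpia : ∀ w : E4, poincareInv mo.1 mo.2 ((mo.1 : E4 ≃L[ℝ] E4) w + mo.2) = w := fun w ↦ by
    simp only [poincareInv, add_sub_cancel_right, ContinuousLinearEquiv.symm_apply_apply]
  -- a point of the open shell
  obtain ⟨y, hy1, hy2⟩ := (F1Route.isConnected_shell a hM).nonempty
  set ry : ℝ := Kerr.radius a (E4.ofTimeSpace 0 y) with hry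
  set z : E4 := E4.ofTimeSpace 0 y with hz
  set xc : E4 := (mo.1 : E4 ≃L[ℝ] E4) z + mo.2 with hxc
  set v : E4 := (mo.1 : E4 ≃L[ℝ] E4) (EuclideanSpace.single (0 : Fin 4) (1 : ℝ)) with hv
  -- the rest-frame time axis through `xc`
  have hpi : ∀ ε : ℝ, poincareInv mo.1 mo.2 (xc + ε • v) = E4.ofTimeSpace ε y := fun ε ↦ by
    rw [hv, KerrSchildChart.poincareInv_add_smul, hxc, hpia, hz, ofTimeSpace_zero_add_smul]
  have hrad : ∀ ε : ℝ, Kerr.radius a (poincareInv mo.1 mo.2 (xc + ε • v)) = ry := fun ε ↦ by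
    rw [hpi, Kerr.radius_ofTimeSpace]
  have htime : ∀ ε : ℝ, poincareInv mo.1 mo.2 (xc + ε • v) 0 = ε := fun ε ↦ by
    rw [hpi, E4.ofTimeSpace_apply_zero]
  have hmem : ∀ ε : ℝ, xc + ε • v ∈ (starBackground mo.1 mo.2 M a
      (fun x => Kerr.radius a (poincareInv mo.1 mo.2 x))).domain := fun ε ↦ by
    show poincareInv mo.1 mo.2 (xc + ε • v) ∈ Kerr.region a M
    rw [Kerr.mem_region, hrad, max_eq_left hM.le]
    exact hy1
  set e : ℝ → (starBackground mo.1 mo.2 M a (fun x => Kerr.radius a (poincareInv mo.1 mo.2 x))).domain :=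
    fun ε ↦ ⟨xc + ε • v, hmem ε⟩ with he_def
  have hec : Continuous e := (continuous_const.add (continuous_id.smul continuous_const)).subtype_mk _
  -- the slab point
  refine ⟨e 0, ⟨?_, ?_⟩, fun W hW ↦ ?_⟩
  · show poincareInv mo.1 mo.2 (xc + (0 : ℝ) • v) 0 = 0
    exact htime 0
  · show Kerr.radius a (poincareInv mo.1 mo.2 (xc + (0 : ℝ) • v)) ≤ 3 * M
    rw [hrad]; exact hy2.le
  -- the approach along the time axis
  set ε₁ : ℝ := (6 * M - 2 * ry) / 3 with hε₁
  have hε₁0 : 0 < ε₁ := by rw [hε₁]; linarith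
  have hΔ : ∀ ε ∈ Ioo 0 ε₁, e ε ∈ F1Route.slabDiamond' (starBackground mo.1 mo.2 M a
      (fun x => Kerr.radius a (poincareInv mo.1 mo.2 x))) M := fun ε hε ↦ by
    refine ⟨?_, ?_⟩
    · show 0 < poincareInv mo.1 mo.2 (xc + ε • v) 0
      rw [htime]; exact hε.1
    · show 3 * (poincareInv mo.1 mo.2 (xc + ε • v) 0) + 2 * Kerr.radius a (poincareInv mo.1 mo.2 (xc + ε • v)) < 6 * M
      rw [htime, hrad]
      have := hε.2; rw [hε₁] at this; linarith
  have hΔs : ∀ ε ∈ Ico 0 ε₁, e ε ∈ F1Route.slabDiamondWithSlab' (starBackground mo.1 mo.2 M a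
      (fun x => Kerr.radius a (poincareInv mo.1 mo.2 x))) M := fun ε hε ↦ by
    refine ⟨?_, ?_⟩
    · show 0 ≤ poincareInv mo.1 mo.2 (xc + ε • v) 0
      rw [htime]; exact hε.1
    · show 3 * (poincareInv mo.1 mo.2 (xc + ε • v) 0) + 2 * Kerr.radius a (poincareInv mo.1 mo.2 (xc + ε • v)) < 6 * M
      rw [htime, hrad]
      have := hε.2; rw [hε₁] at this; linarith
  have he0 : e 0 ∈ F1Route.slabDiamondWithSlab' (starBackground mo.1 mo.2 M a
      (fun x => Kerr.radius a (poincareInv mo.1 mo.2 x))) M := hΔs 0 ⟨le_rfl, hε₁0⟩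
  have hten : Tendsto e (𝓝[>] 0) (𝓝[F1Route.slabDiamondWithSlab' (starBackground mo.1 mo.2 M a
      (fun x => Kerr.radius a (poincareInv mo.1 mo.2 x))) M] (e 0)) := by
    refine tendsto_nhdsWithin_iff.2 ⟨(hec.tendsto 0).mono_left nhdsWithin_le_nhds, ?_⟩
    filter_upwards [Ioo_mem_nhdsGT hε₁0] with ε hε
    exact hΔs ε ⟨hε.1.le, hε.2⟩
  have hΨt : Tendsto (Ψ ∘ e) (𝓝[>] 0) (𝓝 (Ψ (e 0))) := (hc (e 0) he0).tendsto.comp hten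
  have hΨ0 : Ψ (e 0) = Φ₀ (e 0) := hΨΦ (e 0) ⟨htime 0, by
    show Kerr.radius a (poincareInv mo.1 mo.2 (xc + (0 : ℝ) • v)) ≤ 3 * M
    rw [hrad]; exact hy2.le⟩
  rw [hΨ0] at hΨt
  have hev : ∀ᶠ ε in 𝓝[>] (0 : ℝ), Ψ (e ε) ∈ W ∧ e ε ∈ F1Route.slabDiamond'
      (starBackground mo.1 mo.2 M a (fun x => Kerr.radius a (poincareInv mo.1 mo.2 x))) M := by
    filter_upwards [hΨt hW, Ioo_mem_nhdsGT hε₁0] with ε hεW hε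
    exact ⟨hεW, hΔ ε hε⟩
  obtain ⟨ε, hεW, hεΔ⟩ := hev.exists
  exact ⟨e ε, hεΔ, hεW⟩

end KillingPropagation

open KillingPropagation in
/-- **Registered brick `stub_killingPropagation_slabDiamondPreconnected` of
`stub_killingPropagation'` (K1a β')**: the corrected inner diamond `Δ'` of the star background of
a collar chart (`0 < M`) is open and connected. [folklore] -/
theorem stub_killingPropagation_slabDiamondPreconnected : ∀ (mo : lorentzGroup × E4) (M a : ℝ) (B : ModelBackground), 0 < M → B = starBackground mo.1 mo.2 M a (fun x => Kerr.radius a (poincareInv mo.1 mo.2 x)) → IsOpen (F1Route.slabDiamond' B M) ∧ IsPreconnected (F1Route.slabDiamond' B M) :=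
  fun _ _ _ _ hM hB ↦ ⟨isOpen_slabDiamond' hB, isPreconnected_slabDiamond' hM hB⟩

end Summit.FinalStateConjecture.FinalStateConjecture.Theorems.BondiBartnikRigidity.DirectMethod

end
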